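import Mathlib
import Summits.RiemannHypothesis.RiemannHypothesis.Theorems.WeilGroundStateGroundStatesConvergeToXiUniformBound
import Literature.NumberTheory.LFunctions.WeilExplicit
import Literature.NumberTheory.LFunctions.WeilExplicitProofs
import Literature.NumberTheory.LFunctions.WeilMellinBounds
import HarnessLib

/-!
# The uniform bound for the polarised Weil functional at the polar exponent `b₀ = 1/2`
(crux item stmt-RiemannHypothesis-1527 `GroundStatesConvergeToXi`, route
route-RiemannHypothesis-WeilGroundState, line `Sketch`; `--supports`)

`…UniformBound.lean` proves `‖W(f ⋆ h̃₀)‖ ≤ C ∫ |f| e^{b₀|t|}` for every `b₀ > 1/2`, bounding the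
prime sum through `Σ Λ(n) n^{-1/2-b₀} < ∞`.  Here the threshold is brought down to the polar
exponent itself, `b₀ = 1/2` (`norm_weilFunctional_weilConv_weilReflect_le_half`), by double
counting instead of a pointwise bound: `|(f ⋆ h̃₀)(log n)| ≤ H ∫_{|u - log n| ≤ r} |f(u)| du`, so
`Σ Λ(n) n^{-1/2} |(f ⋆ h̃₀)(log n)| ≤ H ∫ |f(u)| S(u) du` with the LOCAL PRIME MASS
`S(u) = Σ_{|u - log n| ≤ r} Λ(n) n^{-1/2} ≤ e^{-(u-r)/2} ψ(e^{u+r}) ≤ (log 4 + 4) e^{3r/2} e^{u/2}`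
by Chebyshev's bound `ψ(x) ≤ (log 4 + 4) x` (Mathlib `Chebyshev.psi_le_const_mul_self`).  The
weight `e^{|t|/2}` is exactly the polar weight (`ĝ(0)`, `ĝ(1)`), so `1/2` is the natural and
final exponent of the method.  Consequence (file `…RHofHalfTight.lean`): every hardness theorem
of the line holds with tightness at `b₀ = 1/2`.
-/

noncomputable section

set_option linter.dupNamespace false

open MeasureTheory Complex Filter Set
open scoped Real Topology ComplexConjugate ArithmeticFunction.vonMangoldt Chebyshev

namespace Summit.RiemannHypothesis.RiemannHypothesis.Theorems.GroundStatesConvergeToXi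

open Literature.NumberTheory.LFunctions

/-! ## The local prime mass `Σ_{|u - log n| ≤ r} Λ(n) n^{-1/2}` -/

/-- **Local prime mass (Chebyshev).**  For real `u`, `r` and any cut-off `N`,
`Σ_{n < N, |u - log n| ≤ r} Λ(n)/√n ≤ (log 4 + 4) e^{3r/2} e^{|u|/2}`: on the range of summation
`√n ≥ e^{(u-r)/2}` and `n ≤ e^{u+r}`, so the sum is at most `e^{-(u-r)/2} ψ(e^{u+r})`, and
`ψ(x) ≤ (log 4 + 4) x`. [folklore] -/
theorem sum_vonMangoldt_div_sqrt_near_le (u r : ℝ) (N : ℕ) :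
    ∑ n ∈ Finset.range N, (if |u - Real.log n| ≤ r then (Λ n : ℝ) / Real.sqrt n else 0) ≤
      (Real.log 4 + 4) * Real.exp (3 * r / 2) * Real.exp (|u| / 2) := by
  set X : ℝ := Real.exp (u + r) with hX
  set w : ℝ := Real.exp (-((u - r) / 2)) with hw
  have hw0 : 0 < w := Real.exp_pos _
  -- termwise comparison with `Λ(n) w 𝟙_{n ∈ Ioc 0 ⌊X⌋}`
  have hterm : ∀ n ∈ Finset.range N,
      (if |u - Real.log n| ≤ r then (Λ n : ℝ) / Real.sqrt n else 0) ≤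
        (if n ∈ Finset.Ioc 0 ⌊X⌋₊ then (Λ n : ℝ) * w else 0) := by
    intro n _
    by_cases h : |u - Real.log n| ≤ r
    · rw [if_pos h]
      rcases Nat.eq_zero_or_pos n with rfl | hn
      · simp only [ArithmeticFunction.map_zero, zero_div, zero_mul, ite_self, le_refl]
      · have hn' : (0 : ℝ) < n := by exact_mod_cast hn
        have hlog := abs_le.1 h
        have hle : (n : ℝ) ≤ X := by
          rw [hX, ← Real.exp_log hn']
          exact Real.exp_le_exp.2 (by linarith [hlog.1])
        have hmem : n ∈ Finset.Ioc 0 ⌊X⌋₊ :=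
          Finset.mem_Ioc.2 ⟨hn, Nat.le_floor hle⟩
        rw [if_pos hmem]
        have hsqrt : Real.exp ((u - r) / 2) ≤ Real.sqrt n := by
          rw [← Real.exp_log hn', ← Real.exp_half]
          exact Real.exp_le_exp.2 (by linarith [hlog.2])
        have hspos : 0 < Real.sqrt n := Real.sqrt_pos.2 hn'
        rw [div_le_iff₀ hspos]
        calc (Λ n : ℝ) = Λ n * (w * Real.exp ((u - r) / 2)) := by
              rw [hw, ← Real.exp_add, neg_add_cancel, Real.exp_zero, mul_one]
          _ = Λ n * w * Real.exp ((u - r) / 2) := by ring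
          _ ≤ Λ n * w * Real.sqrt n :=
              mul_le_mul_of_nonneg_left hsqrt
                (mul_nonneg ArithmeticFunction.vonMangoldt_nonneg hw0.le)
    · rw [if_neg h]
      split_ifs
      · exact mul_nonneg ArithmeticFunction.vonMangoldt_nonneg hw0.le
      · exact le_rfl
  calc ∑ n ∈ Finset.range N, (if |u - Real.log n| ≤ r then (Λ n : ℝ) / Real.sqrt n else 0)
      ≤ ∑ n ∈ Finset.range N, (if n ∈ Finset.Ioc 0 ⌊X⌋₊ then (Λ n : ℝ) * w else 0) :=
        Finset.sum_le_sum hterm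
    _ = ∑ n ∈ (Finset.range N).filter (· ∈ Finset.Ioc 0 ⌊X⌋₊), (Λ n : ℝ) * w :=
        (Finset.sum_filter _ _).symm
    _ ≤ ∑ n ∈ Finset.Ioc 0 ⌊X⌋₊, (Λ n : ℝ) * w :=
        Finset.sum_le_sum_of_subset_of_nonneg (fun n hn => (Finset.mem_filter.1 hn).2)
          fun n _ _ => mul_nonneg ArithmeticFunction.vonMangoldt_nonneg hw0.le
    _ = w * ψ X := by rw [Chebyshev.psi, Finset.mul_sum]; exact Finset.sum_congr rfl fun n _ => mul_comm _ _
    _ ≤ w * ((Real.log 4 + 4) * X) :=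
        mul_le_mul_of_nonneg_left (Chebyshev.psi_le_const_mul_self (Real.exp_pos _).le) hw0.le
    _ = (Real.log 4 + 4) * (w * X) := by ring
    _ = (Real.log 4 + 4) * Real.exp (3 * r / 2) * Real.exp (u / 2) := by
        rw [hw, hX, ← Real.exp_add, mul_assoc, ← Real.exp_add,
          show -((u - r) / 2) + (u + r) = 3 * r / 2 + u / 2 by ring]
    _ ≤ (Real.log 4 + 4) * Real.exp (3 * r / 2) * Real.exp (|u| / 2) := by
        have h4 : 0 ≤ Real.log 4 + 4 := by positivity
        gcongr
        exact le_abs_self u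

/-- The local prime mass in indicator form, centred at the points `log n`:
`Σ_{n<N} Λ(n)/√n · 𝟙[w ∈ B̄(log n, r)] ≤ (log 4 + 4) e^{3r/2} e^{|w|/2}`. [folklore] -/
theorem sum_vonMangoldt_div_sqrt_indicator_le (w r : ℝ) (N : ℕ) :
    ∑ n ∈ Finset.range N, (Metric.closedBall (Real.log n) r).indicator
        (fun _ => (Λ n : ℝ) / Real.sqrt n) w ≤
      (Real.log 4 + 4) * Real.exp (3 * r / 2) * Real.exp (|w| / 2) := by
  classical
  refine le_trans (le_of_eq (Finset.sum_congr rfl fun n _ => ?_))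
    (sum_vonMangoldt_div_sqrt_near_le w r N)
  simp only [Set.indicator_apply, Metric.mem_closedBall, Real.dist_eq]

/-- The same mass centred at the points `-log n`:
`Σ_{n<N} Λ(n)/√n · 𝟙[w ∈ B̄(-log n, r)] ≤ (log 4 + 4) e^{3r/2} e^{|w|/2}` (apply the previous
bound at `-w`). [folklore] -/
theorem sum_vonMangoldt_div_sqrt_indicator_neg_le (w r : ℝ) (N : ℕ) :
    ∑ n ∈ Finset.range N, (Metric.closedBall (-Real.log n) r).indicator
        (fun _ => (Λ n : ℝ) / Real.sqrt n) w ≤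
      (Real.log 4 + 4) * Real.exp (3 * r / 2) * Real.exp (|w| / 2) := by
  classical
  have h := sum_vonMangoldt_div_sqrt_near_le (-w) r N
  rw [abs_neg] at h
  refine le_trans (le_of_eq (Finset.sum_congr rfl fun n _ => ?_)) h
  simp only [Set.indicator_apply, Metric.mem_closedBall, Real.dist_eq]
  have e : |w - -Real.log n| = |-w - Real.log n| := by
    rw [← abs_neg]
    congr 1
    ring
  rw [e]

/-! ## The convolution against the local masses -/

/-- **Pointwise bound of `f ⋆ h̃₀` by the local mass of `f`.**  If `‖h₀‖ ≤ H` and `h₀` vanishes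
off `[-r, r]`, then `‖(f ⋆ h̃₀)(x)‖ ≤ H ∫ 𝟙[u ∈ B̄(x, r)] ‖f(u)‖ du`
(`(f ⋆ h̃₀)(x) = ∫ f(u) conj h₀(u - x) du`). [folklore] -/
theorem norm_weilConv_weilReflect_le_localMass {f h₀ : ℝ → ℂ} (hf : IsWeilTest f)
    {H r : ℝ} (hH : ∀ x, ‖h₀ x‖ ≤ H) (hr : ∀ x, h₀ x ≠ 0 → |x| ≤ r) (x : ℝ) :
    ‖weilConv f (weilReflect h₀) x‖ ≤
      H * ∫ u, (Metric.closedBall x r).indicator (fun u => ‖f u‖) u := by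
  rw [weilConv_apply, ← integral_const_mul]
  have hH0 : 0 ≤ H := (norm_nonneg _).trans (hH 0)
  have hfi : Integrable (fun u => ‖f u‖) :=
    (hf.1.continuous.integrable_of_hasCompactSupport hf.2).norm
  refine norm_integral_le_of_norm_le ((hfi.indicator Metric.isClosed_closedBall.measurableSet).const_mul H)
    (Eventually.of_forall fun u => ?_)
  rw [norm_mul]
  simp only [weilReflect, Complex.norm_conj, neg_sub]
  by_cases hu : h₀ (u - x) = 0
  · rw [hu, norm_zero, mul_zero]
    exact mul_nonneg hH0 (Set.indicator_nonneg (fun _ _ => norm_nonneg _) _)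
  · have hmem : u ∈ Metric.closedBall x r := by
      rw [Metric.mem_closedBall, Real.dist_eq]
      exact hr _ hu
    rw [Set.indicator_of_mem hmem]
    calc ‖f u‖ * ‖h₀ (u - x)‖ ≤ ‖f u‖ * H := mul_le_mul_of_nonneg_left (hH _) (norm_nonneg _)
      _ = H * ‖f u‖ := mul_comm _ _

/-! ## The prime term at the polar exponent -/

/-- **The prime term of `W(f ⋆ h̃₀)` against the polar weight.**  If `‖h₀‖ ≤ H`, `h₀` vanishes
off `[-r, r]`, then for every test function `f`
`‖Σ Λ(n) n^{-1/2} ((f ⋆ h̃₀)(log n) + (f ⋆ h̃₀)(-log n))‖ ≤ 2 H (log 4 + 4) e^{3r/2} ∫ |f| e^{|t|/2}`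
(double counting + Chebyshev, see the module docstring). [folklore] -/
theorem norm_weilPrimeTerm_weilConv_weilReflect_le {f h₀ : ℝ → ℂ} (hf : IsWeilTest f)
    (hh₀ : IsWeilTest h₀) {H r : ℝ} (hH : ∀ x, ‖h₀ x‖ ≤ H) (hr : ∀ x, h₀ x ≠ 0 → |x| ≤ r) :
    ‖weilPrimeTerm (weilConv f (weilReflect h₀))‖ ≤
      2 * H * ((Real.log 4 + 4) * Real.exp (3 * r / 2)) * weilL1 f := by
  set K : ℝ → ℂ := weilConv f (weilReflect h₀) with hKdef
  have hK : IsWeilTest K := hf.weilConv hh₀.weilReflect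
  have hH0 : 0 ≤ H := (norm_nonneg _).trans (hH 0)
  set A : ℝ := (Real.log 4 + 4) * Real.exp (3 * r / 2) with hA
  have hA0 : 0 ≤ A := by positivity
  have hfi : Integrable (fun u => ‖f u‖) :=
    (hf.1.continuous.integrable_of_hasCompactSupport hf.2).norm
  have hL1i : Integrable fun u => ‖f u‖ * Real.exp (|u| / 2) :=
    uniformBound_integrable_norm_mul hf (by fun_prop)
  -- the prime sum is a finite sum
  obtain ⟨R, hR⟩ := hK.2.isCompact.isBounded.subset_closedBall 0
  set N : ℕ := ⌈Real.exp (|R| + 1)⌉₊ with hN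
  have hvan : ∀ n : ℕ, n ∉ Finset.range N →
      ((Λ n : ℝ) : ℂ) / (Real.sqrt n : ℂ) * (K (Real.log n) + K (-Real.log n)) = 0 := by
    intro n hn
    rw [Finset.mem_range, not_lt] at hn
    have hn' : Real.exp (|R| + 1) ≤ n := (Nat.le_ceil _).trans (by exact_mod_cast hn)
    have hpos : (0 : ℝ) < n := (Real.exp_pos _).trans_le hn'
    have hlog : |R| + 1 ≤ Real.log n := by rwa [Real.le_log_iff_exp_le hpos]
    have h0 : ∀ x : ℝ, |R| < |x| → K x = 0 := fun x hx =>
      image_eq_zero_of_notMem_tsupport fun hxs => by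
        have hxR := hR hxs
        rw [Metric.mem_closedBall, dist_zero_right, Real.norm_eq_abs] at hxR
        linarith [le_abs_self R]
    have h1 : |R| < |Real.log n| := lt_of_lt_of_le (by linarith) (le_abs_self _)
    rw [h0 _ h1, h0 _ (by rwa [abs_neg]), add_zero, mul_zero]
  have htsum : weilPrimeTerm K = ∑ n ∈ Finset.range N,
      ((Λ n : ℝ) : ℂ) / (Real.sqrt n : ℂ) * (K (Real.log n) + K (-Real.log n)) :=
    tsum_eq_sum (s := Finset.range N) hvan
  -- local masses
  set mP : ℕ → ℝ := fun n => ∫ u, (Metric.closedBall (Real.log n) r).indicator (fun u => ‖f u‖) u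
  set mN : ℕ → ℝ := fun n => ∫ u, (Metric.closedBall (-Real.log n) r).indicator (fun u => ‖f u‖) u
  have hKP : ∀ n : ℕ, ‖K (Real.log n)‖ ≤ H * mP n := fun n =>
    norm_weilConv_weilReflect_le_localMass hf hH hr _
  have hKN : ∀ n : ℕ, ‖K (-Real.log n)‖ ≤ H * mN n := fun n =>
    norm_weilConv_weilReflect_le_localMass hf hH hr _
  have hcoef : ∀ n : ℕ, 0 ≤ (Λ n : ℝ) / Real.sqrt n := fun n =>
    div_nonneg ArithmeticFunction.vonMangoldt_nonneg (Real.sqrt_nonneg _)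
  -- moving a constant through an indicator
  have hind : ∀ (S : Set ℝ) (c u : ℝ),
      c * S.indicator (fun u => ‖f u‖) u = S.indicator (fun _ => c) u * ‖f u‖ := by
    intro S c u
    by_cases hu : u ∈ S
    · rw [Set.indicator_of_mem hu, Set.indicator_of_mem hu]
    · rw [Set.indicator_of_notMem hu, Set.indicator_of_notMem hu, mul_zero, zero_mul]
  -- double counting: Σ Λ/√n · mP n = ∫ ‖f‖ · (Σ Λ/√n 𝟙) ≤ A · weilL1 f, and the same for mN
  have hintP : ∀ n : ℕ, Integrable fun u =>
      (Metric.closedBall (Real.log n) r).indicator (fun _ => (Λ n : ℝ) / Real.sqrt n) u * ‖f u‖ := by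
    intro n
    exact ((hfi.indicator (Metric.isClosed_closedBall (x := Real.log (n : ℝ)) (ε := r)).measurableSet).const_mul
      ((Λ n : ℝ) / Real.sqrt n)).congr (Eventually.of_forall fun u => hind _ _ u)
  have hintN : ∀ n : ℕ, Integrable fun u =>
      (Metric.closedBall (-Real.log n) r).indicator (fun _ => (Λ n : ℝ) / Real.sqrt n) u * ‖f u‖ := by
    intro n
    exact ((hfi.indicator (Metric.isClosed_closedBall (x := -Real.log (n : ℝ)) (ε := r)).measurableSet).const_mul
      ((Λ n : ℝ) / Real.sqrt n)).congr (Eventually.of_forall fun u => hind _ _ u)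
  have hsumP : ∑ n ∈ Finset.range N, (Λ n : ℝ) / Real.sqrt n * mP n ≤ A * weilL1 f := by
    have e : ∀ n ∈ Finset.range N, (Λ n : ℝ) / Real.sqrt n * mP n =
        ∫ u, (Metric.closedBall (Real.log n) r).indicator (fun _ => (Λ n : ℝ) / Real.sqrt n) u * ‖f u‖ := by
      intro n _
      rw [← integral_const_mul]
      exact integral_congr_ae (Eventually.of_forall fun u => hind _ _ u)
    rw [Finset.sum_congr rfl e, ← integral_finsetSum _ fun n _ => hintP n, weilL1, ← integral_const_mul]
    refine integral_mono_of_nonneg (Eventually.of_forall fun u => Finset.sum_nonneg fun n _ => ?_)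
      (hL1i.const_mul A) (Eventually.of_forall fun u => ?_)
    · exact mul_nonneg (Set.indicator_nonneg (fun _ _ => hcoef n) _) (norm_nonneg _)
    · dsimp only
      rw [← Finset.sum_mul]
      calc (∑ n ∈ Finset.range N, (Metric.closedBall (Real.log n) r).indicator
              (fun _ => (Λ n : ℝ) / Real.sqrt n) u) * ‖f u‖
          ≤ A * Real.exp (|u| / 2) * ‖f u‖ :=
            mul_le_mul_of_nonneg_right (sum_vonMangoldt_div_sqrt_indicator_le u r N) (norm_nonneg _)
        _ = A * (‖f u‖ * Real.exp (|u| / 2)) := by ring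
  have hsumN : ∑ n ∈ Finset.range N, (Λ n : ℝ) / Real.sqrt n * mN n ≤ A * weilL1 f := by
    have e : ∀ n ∈ Finset.range N, (Λ n : ℝ) / Real.sqrt n * mN n =
        ∫ u, (Metric.closedBall (-Real.log n) r).indicator (fun _ => (Λ n : ℝ) / Real.sqrt n) u * ‖f u‖ := by
      intro n _
      rw [← integral_const_mul]
      exact integral_congr_ae (Eventually.of_forall fun u => hind _ _ u)
    rw [Finset.sum_congr rfl e, ← integral_finsetSum _ fun n _ => hintN n, weilL1, ← integral_const_mul]
    refine integral_mono_of_nonneg (Eventually.of_forall fun u => Finset.sum_nonneg fun n _ => ?_)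
      (hL1i.const_mul A) (Eventually.of_forall fun u => ?_)
    · exact mul_nonneg (Set.indicator_nonneg (fun _ _ => hcoef n) _) (norm_nonneg _)
    · dsimp only
      rw [← Finset.sum_mul]
      calc (∑ n ∈ Finset.range N, (Metric.closedBall (-Real.log n) r).indicator
              (fun _ => (Λ n : ℝ) / Real.sqrt n) u) * ‖f u‖
          ≤ A * Real.exp (|u| / 2) * ‖f u‖ :=
            mul_le_mul_of_nonneg_right (sum_vonMangoldt_div_sqrt_indicator_neg_le u r N)
              (norm_nonneg _)
        _ = A * (‖f u‖ * Real.exp (|u| / 2)) := by ring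
  -- assembly
  rw [htsum]
  calc ‖∑ n ∈ Finset.range N, ((Λ n : ℝ) : ℂ) / (Real.sqrt n : ℂ) * (K (Real.log n) + K (-Real.log n))‖
      ≤ ∑ n ∈ Finset.range N, ‖((Λ n : ℝ) : ℂ) / (Real.sqrt n : ℂ) * (K (Real.log n) + K (-Real.log n))‖ :=
        norm_sum_le _ _
    _ ≤ ∑ n ∈ Finset.range N, (Λ n : ℝ) / Real.sqrt n * (H * mP n + H * mN n) := by
        refine Finset.sum_le_sum fun n _ => ?_
        rw [norm_mul, norm_div, Complex.norm_real, Complex.norm_real,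
          Real.norm_of_nonneg ArithmeticFunction.vonMangoldt_nonneg,
          Real.norm_of_nonneg (Real.sqrt_nonneg _)]
        exact mul_le_mul_of_nonneg_left (norm_add_le_of_le (hKP n) (hKN n)) (hcoef n)
    _ = H * (∑ n ∈ Finset.range N, (Λ n : ℝ) / Real.sqrt n * mP n) +
          H * (∑ n ∈ Finset.range N, (Λ n : ℝ) / Real.sqrt n * mN n) := by
        rw [Finset.mul_sum, Finset.mul_sum, ← Finset.sum_add_distrib]
        exact Finset.sum_congr rfl fun n _ => by ring
    _ ≤ H * (A * weilL1 f) + H * (A * weilL1 f) :=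
        add_le_add (mul_le_mul_of_nonneg_left hsumP hH0) (mul_le_mul_of_nonneg_left hsumN hH0)
    _ = 2 * H * A * weilL1 f := by ring

/-! ## The uniform bound at `b₀ = 1/2` -/

/-- `weilL1 f = ∫ ‖f‖ e^{(1/2)|t|}` (the tightness weight of the line at `b = 1/2`). [folklore] -/
theorem weilL1_eq_integral_half (f : ℝ → ℂ) :
    weilL1 f = ∫ t : ℝ, ‖f t‖ * Real.exp (1 / 2 * |t|) := by
  unfold weilL1
  exact integral_congr_ae (Eventually.of_forall fun t => by
    dsimp only
    rw [show |t| / 2 = 1 / 2 * |t| by ring])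

/-- (B½) **Uniform bound for the polarised Weil functional at the polar exponent.**  For a test
function `h₀` there is `C ≥ 0` with `‖W(f ⋆ h̃₀)‖ ≤ C ∫ |f(t)| e^{|t|/2} dt` for every test
function `f`: polar term `|f̂(0)|, |f̂(1)| ≤ ∫|f|e^{|t|/2}`; prime term by
`norm_weilPrimeTerm_weilConv_weilReflect_le` (Chebyshev); archimedean term `|f̂(1/2+iτ)| ≤ ∫|f|`
against the integrable `|ĥ̃₀(1/2+iτ)| |Re ψ(1/4+iτ/2)|` and `|(f ⋆ h̃₀)(0)| ≤ H e^{r/2} ∫|f|e^{|t|/2}`.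
This is `norm_weilFunctional_weilConv_weilReflect_le` with the threshold `b₀ > 1/2` lowered to
`b₀ = 1/2`. [folklore] -/
theorem norm_weilFunctional_weilConv_weilReflect_le_half {h₀ : ℝ → ℂ} (hh₀ : IsWeilTest h₀) :
    ∃ C : ℝ, 0 ≤ C ∧ ∀ f : ℝ → ℂ, IsWeilTest f →
      ‖weilFunctional (weilConv f (weilReflect h₀))‖ ≤
        C * ∫ t, ‖f t‖ * Real.exp (1 / 2 * |t|) := by
  -- data attached to `h₀`
  obtain ⟨H, hH⟩ := hh₀.1.continuous.bounded_above_of_compact_support hh₀.2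
  have hH0 : 0 ≤ H := (norm_nonneg _).trans (hH 0)
  obtain ⟨r, -, hr⟩ := hh₀.2.isCompact.isBounded.subset_closedBall_lt 0 0
  have hr' : ∀ x, h₀ x ≠ 0 → |x| ≤ r := fun x hx => by
    have h := hr (subset_tsupport _ hx)
    simpa using h
  have hR : IsWeilTest (weilReflect h₀) := hh₀.weilReflect
  have hInt := uniformBound_integrable_weilArchIntegrand hR
  set A : ℝ := (Real.log 4 + 4) * Real.exp (3 * r / 2) with hA
  have hA0 : 0 ≤ A := by positivity
  have hE0 : 0 ≤ H * Real.exp (1 / 2 * r) := by positivity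
  have hI0 : 0 ≤ ∫ t : ℝ, ‖weilMellin (weilReflect h₀) (1 / 2 + t * I) *
      ((Complex.digamma (1 / 4 + t / 2 * I)).re : ℂ)‖ := integral_nonneg fun _ => norm_nonneg _
  refine ⟨(‖weilMellin (weilReflect h₀) 0‖ + ‖weilMellin (weilReflect h₀) 1‖) +
      2 * H * A +
      ‖(1 / (2 * π) : ℂ)‖ * (∫ t : ℝ, ‖weilMellin (weilReflect h₀) (1 / 2 + t * I) *
        ((Complex.digamma (1 / 4 + t / 2 * I)).re : ℂ)‖) +
      H * Real.exp (1 / 2 * r) * ‖(Real.log π : ℂ)‖, by positivity, fun f hf => ?_⟩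
  set If : ℝ := ∫ t, ‖f t‖ * Real.exp (1 / 2 * |t|) with hIf
  have hIf0 : 0 ≤ If := integral_nonneg fun _ => by positivity
  have hL1 : weilL1 f = If := weilL1_eq_integral_half f
  set K : ℝ → ℂ := weilConv f (weilReflect h₀) with hKdef
  -- Mellin factorisation and the strip bound for `f̂`
  have hMK : ∀ s, weilMellin K s = weilMellin f s * weilMellin (weilReflect h₀) s :=
    weilMellin_weilConv_holds hf.1.continuous hf.2 hR.1.continuous hR.2
  have hfM : ∀ s : ℂ, 0 ≤ s.re → s.re ≤ 1 → ‖weilMellin f s‖ ≤ If := fun s h0 h1 =>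
    uniformBound_norm_weilMellin_le hf le_rfl h0 h1
  -- polar term
  have hPol : ‖weilPolarTerm K‖ ≤
      (‖weilMellin (weilReflect h₀) 0‖ + ‖weilMellin (weilReflect h₀) 1‖) * If := by
    rw [weilPolarTerm, hMK, hMK]
    calc ‖weilMellin f 0 * weilMellin (weilReflect h₀) 0 +
          weilMellin f 1 * weilMellin (weilReflect h₀) 1‖
        ≤ ‖weilMellin f 0‖ * ‖weilMellin (weilReflect h₀) 0‖ +
            ‖weilMellin f 1‖ * ‖weilMellin (weilReflect h₀) 1‖ :=
          (norm_add_le _ _).trans_eq (by rw [norm_mul, norm_mul])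
      _ ≤ If * ‖weilMellin (weilReflect h₀) 0‖ + If * ‖weilMellin (weilReflect h₀) 1‖ := by
          gcongr
          · exact hfM 0 (by simp) (by simp)
          · exact hfM 1 (by simp) (by simp)
      _ = _ := by ring
  -- prime term (Chebyshev)
  have hPr : ‖weilPrimeTerm K‖ ≤ 2 * H * A * If := by
    rw [← hL1]
    exact norm_weilPrimeTerm_weilConv_weilReflect_le hf hh₀ hH hr'
  -- archimedean term
  have hAI : ‖weilArchIntegral K‖ ≤ If * ∫ t : ℝ, ‖weilMellin (weilReflect h₀) (1 / 2 + t * I) *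
      ((Complex.digamma (1 / 4 + t / 2 * I)).re : ℂ)‖ := by
    unfold weilArchIntegral
    refine (norm_integral_le_of_norm_le (hInt.norm.const_mul If)
      (Eventually.of_forall fun t => ?_)).trans_eq (integral_const_mul _ _)
    rw [hMK, mul_assoc, norm_mul]
    exact mul_le_mul_of_nonneg_right (hfM _ (by simp) (by norm_num)) (norm_nonneg _)
  have hK0 : ‖K 0‖ ≤ H * Real.exp (1 / 2 * r) * If := by
    have h := uniformBound_norm_weilConv_weilReflect_le hf hH hr' (by norm_num : (0:ℝ) ≤ 1 / 2) 0
    rw [abs_zero, mul_zero, neg_zero, Real.exp_zero, mul_one] at h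
    exact h
  have hArch : ‖weilArchTerm K‖ ≤
      ‖(1 / (2 * π) : ℂ)‖ * (If * ∫ t : ℝ, ‖weilMellin (weilReflect h₀) (1 / 2 + t * I) *
        ((Complex.digamma (1 / 4 + t / 2 * I)).re : ℂ)‖) +
      H * Real.exp (1 / 2 * r) * If * ‖(Real.log π : ℂ)‖ := by
    unfold weilArchTerm
    refine (norm_sub_le _ _).trans ?_
    rw [norm_mul, norm_mul]
    exact add_le_add (mul_le_mul_of_nonneg_left hAI (norm_nonneg _))
      (mul_le_mul_of_nonneg_right hK0 (norm_nonneg _))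
  -- assembly
  calc ‖weilFunctional K‖ ≤ ‖weilPolarTerm K‖ + ‖weilPrimeTerm K‖ + ‖weilArchTerm K‖ :=
        norm_add_le_of_le (norm_sub_le _ _) le_rfl
    _ ≤ _ := add_le_add (add_le_add hPol hPr) hArch
    _ = _ := by ring

end Summit.RiemannHypothesis.RiemannHypothesis.Theorems.GroundStatesConvergeToXi

end
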